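import Mathlib
import HarnessLib
import Literature.Analysis.Convex.KrasnoselskijIteration
import Literature.Analysis.Convex.ConvexMetricProjection
import Literature.Analysis.Convex.BrowderCurveStrongConvergence
import Literature.Analysis.Convex.IshikawaNonexpansive
import Literature.Analysis.Convex.MannQuasiNonexpansive

/-!
# Weak convergence of the Krasnoselskij iteration in Hilbert space, via asymptotic centres

Literature anchor (the STATEMENTS follow the sources; the PROOF ROUTE is Edelstein's asymptotic
centre, chosen because it needs no weak compactness — see "Proof route" below; nothing here is new
mathematics):

* [Ber07] V. Berinde, *Iterative Approximation of Fixed Points*, 2nd ed., Lecture Notes in Math.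
  1912, Springer 2007 (held: `lit` key `book:berinde2007-iterative-approximation-fixed-points`;
  bib `Berinde2007`), Chapter 3 §3.1: **Theorem 3.3** (`H` Hilbert, `T` nonexpansive self-map of
  a bounded closed convex `C`, `F_T = {p}` ⇒ the Krasnoselskij iteration `U_λ^n x₀ ⇀ p` for every
  `x₀ ∈ C`) and **Theorem 3.4** (same setting, no uniqueness assumption ⇒ `U_λ^n x₀` converges
  weakly to a fixed point of `T`), with the book's attributions (§3.6): Thm 3.3 is Theorem 7 and
  Thm 3.4 is Theorem 8 of Browder–Petryshyn [BrP67]; Chapter 3, Exercise 3.18 (**Opial's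
  condition**, [Op67a]) and Exercise 3.19 (Browder–Petryshyn: weak limits along an asymptotically
  regular orbit are fixed points); Chapter 4, Definition 4.2 and Remark 2 after Theorem 4.7
  (**demiclosedness** of `I − T` for nonexpansive `T`, after Opial); Chapter 6 §6.3,
  **Definition 6.5** (the **asymptotic centre** of a bounded sequence, Edelstein's construction).
* [BrP67] F. E. Browder, W. V. Petryshyn, *Construction of fixed points of nonlinear mappings in
  Hilbert space*, J. Math. Anal. Appl. 20 (1967) 197–228 (bib `BrowderPetryshyn1967`; not held —
  acquisition request filed; theorem numbers as reported in [Ber07, §3.6]).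
* [Ede72] M. Edelstein, *The construction of an asymptotic center with a fixed-point property*,
  Bull. Amer. Math. Soc. 78 (1972) 206–208 (bib `Edelstein1972`).
* [GK90] K. Goebel, W. A. Kirk, *Topics in Metric Fixed Point Theory*, Cambridge 1990 (held; bib
  `GoebelKirk1990`), Chapter 9: the asymptotic radius `r(x, {x_n}) = limsup ‖x − x_n‖` ((9.1)), the
  asymptotic centre ((9.2)–(9.3)), and **Lemma 9.3** (`r(Tz, {y_n}) ≤ r(z, {y_n})` for a bounded
  approximate fixed point sequence `y_n` of a nonexpansive `T`).
* [Op67a] Z. Opial, *Weak convergence of the sequence of successive approximations for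
  nonexpansive mappings*, Bull. Amer. Math. Soc. 73 (1967) 591–597 (bib `Opial1967`; cited through
  [Ber07]).

Everything is proved; there are no named facts and no `sorry`.

## What is formalised

`E` is a real inner product space; completeness (`[CompleteSpace E]`, i.e. `E` a real Hilbert
space) is assumed exactly where it is used. Weak convergence `u_n ⇀ q` is written as convergence
of all inner products, `∀ y, ⟪y, u_n⟫ → ⟪y, q⟫`, and translated into Mathlib's weak topology
(`toWeakSpace ℝ E (u n) → toWeakSpace ℝ E q`) by `tendsto_toWeakSpace_of_forall_inner` /
`forall_inner_of_tendsto_toWeakSpace` (Riesz representation).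

* The (squared) **asymptotic radius functional** `asymRadiusSq u z = limsup_n ‖u_n − z‖²` of a
  bounded sequence and **asymptotic centres** `IsAsymCenter u c` (global minimisers of
  `asymRadiusSq u`; [Ber07, Def 6.5], [GK90, (9.1)–(9.3)] — squaring the radius does not change the
  minimisers and makes the parallelogram law available): bounds, the ε-characterisation, the value
  `ℓ²` along convergent distances (`asymRadiusSq_eq_of_tendsto`), monotonicity under passing to a
  subsequence, the **midpoint (strong convexity) inequality** `asymRadiusSq_midpoint_le`, a local
  Lipschitz estimate and continuity, [GK90, Lemma 9.3] (`asymRadiusSq_apply_le`: `r(Tc) ≤ r(c)`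
  along an approximate fixed point sequence of a nonexpansive `T`).
* **Existence** (`exists_isAsymCenter`, `E` complete: a minimising sequence is Cauchy by strong
  convexity) and **uniqueness** (`IsAsymCenter.unique`) of the asymptotic centre, the growth
  inequality `‖z − c‖² ≤ 2 (r(z) − r(c))` (`IsAsymCenter.norm_sub_sq_le`), Edelstein's
  **fixed-point property** (`IsAsymCenter.apply_eq`: the asymptotic centre of a bounded approximate
  fixed point sequence of a nonexpansive map is a fixed point, [Ede72], [GK90, Lemma 9.3]), and
  `IsAsymCenter.mem_of_forall_mem` (the centre of a sequence in a closed convex `K` lies in `K`).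
* **Opial's lemma in Hilbert space** (`asymRadiusSq_eq_add_of_weak_tendsto`:
  `u_n ⇀ q ⇒ r(z) = r(q) + ‖z − q‖²`; hence the weak limit is the asymptotic centre,
  `isAsymCenter_of_weak_tendsto`, and **Opial's condition** `asymRadiusSq_lt_of_weak_tendsto`,
  [Ber07, Exercise 3.18]) and the **demiclosedness principle** for `I − T` at `0`
  (`apply_eq_of_weak_tendsto`, [Ber07, Ch. 4, Remark 2 after Thm 4.7]) — both for sequences and
  without any compactness.
* The **weak convergence principle** `exists_fixedPoint_weak_tendsto`: in a real Hilbert space, a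
  bounded sequence `x_n` with `‖x_n − T x_n‖ → 0` which is Fejér monotone with respect to the fixed
  points of the nonexpansive map `T` converges weakly to a fixed point of `T`, namely to its
  asymptotic centre (this is the common core of [Ber07, Thms 3.3–3.4] = [BrP67, Thms 7–8],
  [Ber07, Exercise 3.19] and [Op67a]); `weak_limit_unique` records that weak limits are unique.
* **[Ber07, Thm 3.4] = [BrP67, Thm 8]**: `kmIter_weak_tendsto` (whole-space form: `T : E → E`
  nonexpansive with a fixed point, `0 < λ < 1` ⇒ the Krasnoselskij iterates `kmIter T λ x₀`
  of `Literature.Analysis.Convex.KrasnoselskijIteration` converge weakly to a fixed point, which is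
  their asymptotic centre) and AS PRINTED `kmIter_weak_tendsto_of_mapsTo` (`C` bounded closed
  convex, `T` nonexpansive on `C` with `T(C) ⊆ C`, `x₀ ∈ C`: the iterates stay in `C` and
  converge weakly to a fixed point `q ∈ C`; the fixed point needed to start is Browder's theorem
  of the tree, `BrowderCurveStrongConvergence.exists_fixedPoint_of_nonexpansiveOn`);
  **[Ber07, Thm 3.3] = [BrP67, Thm 7]**: `kmIter_weak_tendsto_of_unique_fixedPoint`; the
  `WeakSpace` forms `kmIter_tendsto_toWeakSpace`, `kmIter_tendsto_toWeakSpace_of_mapsTo`.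
* **Picard iteration of an asymptotically regular nonexpansive map** ([Ber07, Exercise 3.19 and
  §3.6: Browder–Petryshyn, Opial]): `iterate_weak_tendsto_of_asymptoticallyRegular`.
* **Bridges discharging hypotheses of the tree in Hilbert space**: weakly convergent sequences are
  bounded (`exists_norm_le_of_weak_tendsto`, uniform boundedness); `r_u(z) = (limsup ‖u_n − z‖)²`
  (`asymRadiusSq_eq_limsup_norm_sq`); every real inner product space satisfies the tree's
  `IshikawaNonexpansive.OpialCondition` (`opialCondition`, [Ber07, Exercise 3.18] — the hypothesis
  `hO` of the tree's Theorems 5.4/5.5 is thereby discharged for Hilbert spaces); and for `T`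
  nonexpansive on a closed convex `C` of a Hilbert space, `I − T` is demiclosed on `C` in the sense
  of the tree's `MannQuasiNonexpansive.demiclosedOn` (`demiclosedOn_of_nonexpansiveOn`, [Ber07,
  Ch. 4, Remark 2 after Thm 4.7] — the hypothesis `hdemi` of the tree's Theorem 4.7 (i)).

## Proof route (declared deviation from the printed proofs)

[Ber07] proves Thm 3.3 by extracting weakly convergent subsequences (weak compactness of bounded
sets) and identifying their limits through the identity
`‖x_{n_j} − U_λ p₀‖² = ‖x_{n_j} − p₀‖² + ‖p₀ − U_λ p₀‖² + 2⟨x_{n_j} − p₀, p₀ − U_λ p₀⟩` (his (5)),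
and Thm 3.4 by minimising `g(p) = lim ‖x_n − p‖` over `F_T` (weak compactness again). Mathlib
(v4.32) has no weak sequential compactness of the ball of a Hilbert space, so we run the SAME two
computations without subsequence extraction in `E`: the functional minimised is
`z ↦ limsup ‖x_n − z‖²` over all of `E` (its minimiser exists by completeness alone, because the
parallelogram law makes it strongly convex — this is Edelstein's asymptotic centre [Ede72],
[Ber07, Def 6.5]); the identity (5) becomes Opial's identity `r(z) = r(q) + ‖z − q‖²`; and "every
weak cluster point equals `p₀`" becomes: if `⟨y, x_n − c⟩ ↛ 0` then along a subsequence
`⟨y, x_n − c⟩ → σ ≠ 0` (Bolzano–Weierstrass in `ℝ` only), the asymptotic centre of that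
subsequence is again `c` (Fejér monotonicity makes `‖x_n − p‖` converge for every fixed point
`p`), and `r(c + t y) = ℓ² − 2 t σ + t² ‖y‖² < ℓ² = r(c)` for `t = σ / ‖y‖²` contradicts
minimality. The statements proved are the printed ones (and slightly more: the weak limit is
identified as the asymptotic centre of the iterates, cf. [Ber07, Thm 6.10]).

Other deviations: `T` is a map `E → E` throughout; in the "as printed" forms only its restriction
to `C` enters (`∀ x ∈ C, ∀ y ∈ C, ‖T x − T y‖ ≤ ‖x − y‖`, `MapsTo T C C`) and the auxiliary
extension `T ∘ P_C` (nonexpansive on `E`, equal to `T` on `C`) is used internally; `λ ∈ (0, 1)` as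
in [Ber07, (1)].

## Mathlib / tree search (dedup)

`lean search 'asymptotic cent|asymRadius|IsAsymCenter|demiclosed'` (declarations): no matches in
Mathlib or the tree; Mathlib has the weak topology (`WeakSpace`, `toWeakSpace`) but no
Opial lemma / demiclosedness principle / asymptotic centres. Tree: `KrasnoselskijIteration`
(Thm 3.2: Fejér monotonicity `norm_kmIter_succ_sub_le`, asymptotic regularity
`tendsto_norm_kmIter_sub_apply`, the identity `norm_sq_convex_combination` — USED, not re-proved;
its header lists Thms 3.3–3.4 as not formalised), `ConvexMetricProjection` (`proj`, `proj_mem`,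
`proj_eq_self`, `norm_proj_sub_proj_le`, `norm_proj_sub_proj_sq_add_le` — used),
`BrowderCurveStrongConvergence` (Browder's fixed point theorem `exists_fixedPoint_of_nonexpansiveOn`
— used), `IshikawaNonexpansive` (the HYPOTHESIS structure `OpialCondition E` and demiclosedness
under it, `apply_eq_self_of_weak_tendsto`, for uniformly convex spaces with an explicit
weak-sequential-compactness hypothesis — we PROVE `OpialCondition E` for inner product spaces),
`MannQuasiNonexpansive` (the HYPOTHESIS `demiclosedOn T C` of Thm 4.7 (i) — we prove it for
nonexpansive `T` in Hilbert space). Nothing landed is redeclared.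
-/

open Filter Topology
open scoped RealInnerProductSpace

namespace Literature.Analysis.Convex.KrasnoselskijWeakConvergence

/-! ## A small toolkit on `limsup` of bounded real sequences -/

section RealToolkit

variable {f a : ℕ → ℝ} {L M U : ℝ}

/-- `limsup f ≤ M` from the bounds `f_n ≤ M + ε` eventually, for every `ε > 0` (for a sequence
bounded below). [folklore] -/
private theorem limsup_le_of_forall_eventually_le_add (hf : ∀ n, L ≤ f n)
    (h : ∀ ε : ℝ, 0 < ε → ∀ᶠ n in atTop, f n ≤ M + ε) : limsup f atTop ≤ M :=
  le_of_forall_pos_le_add fun ε hε =>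
    Filter.limsup_le_of_le (Filter.isCoboundedUnder_le_of_le atTop hf) (h ε hε)

/-- Eventually `a_n ≤ limsup a + ε` (for a sequence bounded above). [folklore] -/
private theorem eventually_le_limsup_add (ha : ∀ n, a n ≤ U) {ε : ℝ} (hε : 0 < ε) :
    ∀ᶠ n in atTop, a n ≤ limsup a atTop + ε :=
  (Filter.eventually_lt_of_limsup_lt (lt_add_of_pos_right _ hε)
    (Filter.isBoundedUnder_of ⟨U, fun n => ha n⟩)).mono fun _ h => h.le

/-- A lower bound passes to the `limsup` (bounded sequence). [folklore] -/
private theorem le_limsup_of_forall_le (hf : ∀ n, L ≤ f n) (hU : ∀ n, f n ≤ U) :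
    L ≤ limsup f atTop :=
  Filter.le_limsup_of_frequently_le (Filter.Frequently.of_forall hf)
    (Filter.isBoundedUnder_of ⟨U, fun n => hU n⟩)

/-- An upper bound passes to the `limsup` (bounded sequence). [folklore] -/
private theorem limsup_le_of_forall_le (hf : ∀ n, L ≤ f n) (hU : ∀ n, f n ≤ U) :
    limsup f atTop ≤ U :=
  Filter.limsup_le_of_le (Filter.isCoboundedUnder_le_of_le atTop hf) (Eventually.of_forall hU)

/-- Comparison modulo a null sequence: `f_n ≤ a_n + e_n` eventually with `e_n → 0` gives
`limsup f ≤ limsup a` (bounded sequences). [folklore] -/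
private theorem limsup_le_limsup_of_le_add {e : ℕ → ℝ} (hf : ∀ n, L ≤ f n) (ha : ∀ n, a n ≤ U)
    (he : Tendsto e atTop (𝓝 0)) (h : ∀ᶠ n in atTop, f n ≤ a n + e n) :
    limsup f atTop ≤ limsup a atTop := by
  refine limsup_le_of_forall_eventually_le_add hf fun ε hε => ?_
  have h1 := eventually_le_limsup_add ha (half_pos hε)
  have h2 : ∀ᶠ n in atTop, e n < ε / 2 := he.eventually (gt_mem_nhds (half_pos hε))
  filter_upwards [h, h1, h2] with n hn h1n h2n
  linarith

/-- The `limsup` along a subsequence is at most the `limsup` (bounded sequence). [folklore] -/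
private theorem limsup_comp_le {φ : ℕ → ℕ} (hφ : StrictMono φ) (hf : ∀ n, L ≤ a n)
    (ha : ∀ n, a n ≤ U) : limsup (a ∘ φ) atTop ≤ limsup a atTop := by
  refine limsup_le_of_forall_eventually_le_add (fun n => hf (φ n)) fun ε hε => ?_
  exact hφ.tendsto_atTop.eventually (eventually_le_limsup_add ha hε)

end RealToolkit

variable {E : Type*} [NormedAddCommGroup E] [InnerProductSpace ℝ E]

/-! ## Weak convergence in a Hilbert space: inner products versus `WeakSpace` -/

/-- The pairing `x ↦ (φ ↦ φ x)` of `E` with its dual is injective on a real inner product space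
(the functionals `⟪v, ·⟫` separate points; no Hahn–Banach needed). [folklore] -/
private theorem flip_topDualPairing_injective :
    Function.Injective ((topDualPairing ℝ E).flip : E →ₗ[ℝ] StrongDual ℝ E →ₗ[ℝ] ℝ) := by
  intro x y h
  have h1 : ∀ φ : StrongDual ℝ E, φ x = φ y := fun φ => by
    have := congrArg (fun B => B φ) h
    simpa [topDualPairing_apply] using this
  have h2 := h1 (innerSL ℝ (x - y))
  simp only [innerSL_apply_apply] at h2
  rw [← sub_eq_zero, ← inner_self_eq_zero (𝕜 := ℝ), inner_sub_right, h2, sub_self]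

/-- **Inner products ⇒ weak topology** (Riesz): in a real Hilbert space, if `⟪y, u_n⟫ → ⟪y, q⟫`
for every `y`, then `u_n → q` in `WeakSpace ℝ E`. [cite: Berinde2007, Ch. 3 §3.1, Thm 3.3
(weak convergence `⇀`)] -/
theorem tendsto_toWeakSpace_of_forall_inner [CompleteSpace E] {u : ℕ → E} {q : E}
    (h : ∀ y : E, Tendsto (fun n => ⟪y, u n⟫) atTop (𝓝 ⟪y, q⟫)) :
    Tendsto (fun n => toWeakSpace ℝ E (u n)) atTop (𝓝 (toWeakSpace ℝ E q)) := by
  refine (WeakBilin.tendsto_iff_forall_eval_tendsto (B := (topDualPairing ℝ E).flip)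
    flip_topDualPairing_injective).2 fun φ => ?_
  have h' : Tendsto (fun n => φ (u n)) atTop (𝓝 (φ q)) := by
    have := h ((InnerProductSpace.toDual ℝ E).symm φ)
    simp only [InnerProductSpace.toDual_symm_apply] at this
    exact this
  exact h'

/-- **Weak topology ⇒ inner products**: if `u_n → q` in `WeakSpace ℝ E` then `⟪y, u_n⟫ → ⟪y, q⟫`
for every `y` (each `⟪y, ·⟫` is a continuous functional). [cite: Berinde2007, Ch. 3 §3.1,
Thm 3.3 (weak convergence `⇀`)] -/
theorem forall_inner_of_tendsto_toWeakSpace {u : ℕ → E} {q : E}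
    (h : Tendsto (fun n => toWeakSpace ℝ E (u n)) atTop (𝓝 (toWeakSpace ℝ E q))) (y : E) :
    Tendsto (fun n => ⟪y, u n⟫) atTop (𝓝 ⟪y, q⟫) := by
  have hc := ((WeakBilin.eval_continuous (topDualPairing ℝ E).flip (innerSL ℝ y)).tendsto
    (toWeakSpace ℝ E q)).comp h
  exact hc

/-- Weak limits (in the inner-product formulation) are unique. [cite: Berinde2007, Ch. 3 §3.1,
Thm 3.3] -/
theorem weak_limit_unique {u : ℕ → E} {q q' : E}
    (h : ∀ y : E, Tendsto (fun n => ⟪y, u n⟫) atTop (𝓝 ⟪y, q⟫))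
    (h' : ∀ y : E, Tendsto (fun n => ⟪y, u n⟫) atTop (𝓝 ⟪y, q'⟫)) : q = q' := by
  have key : ∀ y : E, ⟪y, q⟫ = ⟪y, q'⟫ := fun y => tendsto_nhds_unique (h y) (h' y)
  have h2 := key (q - q')
  rw [← sub_eq_zero, ← inner_self_eq_zero (𝕜 := ℝ), inner_sub_right, h2, sub_self]

/-! ## The asymptotic radius functional and asymptotic centres -/

/-- The (squared) **asymptotic radius functional** of a sequence `u`:
`r_u(z) = limsup_{n → ∞} ‖u_n − z‖²` ([GK90, (9.1)] squared; [Ber07, Def 6.5] uses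
`r_m(x) = sup_{n ≥ m} ‖u_n − x‖`, whose limit in `m` is the un-squared radius).
[cite: Berinde2007, Ch. 6 §6.3, Def 6.5] [cite: GoebelKirk1990, Ch. 9, (9.1)] -/
noncomputable def asymRadiusSq (u : ℕ → E) (z : E) : ℝ :=
  limsup (fun n => ‖u n - z‖ ^ 2) atTop

/-- `c` is an **asymptotic centre** of the sequence `u` (with respect to the whole space): a global
minimiser of the asymptotic radius functional. [cite: Berinde2007, Ch. 6 §6.3, Def 6.5]
[cite: GoebelKirk1990, Ch. 9, (9.2)–(9.3)] [cite: Edelstein1972, §1] -/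
def IsAsymCenter (u : ℕ → E) (c : E) : Prop :=
  ∀ z, asymRadiusSq u c ≤ asymRadiusSq u z

variable {u : ℕ → E} {R : ℝ} {c c' q z w : E}

omit [InnerProductSpace ℝ E] in
/-- Pointwise bound: `‖u_n − z‖² ≤ (R + ‖z‖)²` for a sequence bounded by `R`. [folklore] -/
private theorem norm_sub_sq_le_bound (hu : ∀ n, ‖u n‖ ≤ R) (z : E) (n : ℕ) :
    ‖u n - z‖ ^ 2 ≤ (R + ‖z‖) ^ 2 := by
  have h1 : ‖u n - z‖ ≤ R + ‖z‖ := (norm_sub_le _ _).trans (add_le_add (hu n) le_rfl)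
  exact pow_le_pow_left₀ (norm_nonneg _) h1 2

omit [InnerProductSpace ℝ E] in
/-- `0 ≤ r_u(z)`. [cite: GoebelKirk1990, Ch. 9, (9.1)] -/
theorem asymRadiusSq_nonneg (hu : ∀ n, ‖u n‖ ≤ R) (z : E) : 0 ≤ asymRadiusSq u z :=
  le_limsup_of_forall_le (fun _ => sq_nonneg _) (norm_sub_sq_le_bound hu z)

omit [InnerProductSpace ℝ E] in
/-- `r_u(z) ≤ (R + ‖z‖)²` for a sequence bounded by `R`. [cite: GoebelKirk1990, Ch. 9, (9.1)] -/
theorem asymRadiusSq_le (hu : ∀ n, ‖u n‖ ≤ R) (z : E) : asymRadiusSq u z ≤ (R + ‖z‖) ^ 2 :=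
  limsup_le_of_forall_le (fun _ => sq_nonneg _) (norm_sub_sq_le_bound hu z)

omit [InnerProductSpace ℝ E] in
/-- The ε-characterisation: eventually `‖u_n − z‖² ≤ r_u(z) + ε`.
[cite: GoebelKirk1990, Ch. 9, (9.1)] -/
theorem eventually_norm_sub_sq_le (hu : ∀ n, ‖u n‖ ≤ R) (z : E) {ε : ℝ} (hε : 0 < ε) :
    ∀ᶠ n in atTop, ‖u n - z‖ ^ 2 ≤ asymRadiusSq u z + ε :=
  eventually_le_limsup_add (norm_sub_sq_le_bound hu z) hε

omit [InnerProductSpace ℝ E] in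
/-- If the distances converge, `‖u_n − z‖ → ℓ`, then `r_u(z) = ℓ²`.
[cite: GoebelKirk1990, Ch. 9, (9.1)] -/
theorem asymRadiusSq_eq_of_tendsto {ℓ : ℝ} (h : Tendsto (fun n => ‖u n - z‖) atTop (𝓝 ℓ)) :
    asymRadiusSq u z = ℓ ^ 2 :=
  (h.pow 2).limsup_eq

omit [InnerProductSpace ℝ E] in
/-- Passing to a subsequence does not increase the asymptotic radius: `r_{u ∘ φ}(z) ≤ r_u(z)`.
[cite: GoebelKirk1990, Ch. 9, (9.1)] -/
theorem asymRadiusSq_comp_le (hu : ∀ n, ‖u n‖ ≤ R) {φ : ℕ → ℕ} (hφ : StrictMono φ) (z : E) :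
    asymRadiusSq (u ∘ φ) z ≤ asymRadiusSq u z :=
  limsup_comp_le (a := fun n => ‖u n - z‖ ^ 2) hφ (fun _ => sq_nonneg _) (norm_sub_sq_le_bound hu z)

/-- **Midpoint (strong convexity) inequality**, from the parallelogram law:
`r_u(½(z + w)) ≤ ½ r_u(z) + ½ r_u(w) − ¼ ‖z − w‖²`. This is what makes asymptotic centres exist
and be unique in Hilbert space without any compactness ([GK90, Ch. 9, property (c)] is the convexity
of the un-squared radius; cf. [GK90, Thm 9.2]). [cite: GoebelKirk1990, Ch. 9, (9.1) property (c)]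
[cite: Edelstein1972, Thm 1] -/
theorem asymRadiusSq_midpoint_le (hu : ∀ n, ‖u n‖ ≤ R) (z w : E) :
    asymRadiusSq u ((2 : ℝ)⁻¹ • (z + w)) ≤
      asymRadiusSq u z / 2 + asymRadiusSq u w / 2 - ‖z - w‖ ^ 2 / 4 := by
  have hpt : ∀ n, ‖u n - (2 : ℝ)⁻¹ • (z + w)‖ ^ 2 =
      ‖u n - z‖ ^ 2 / 2 + ‖u n - w‖ ^ 2 / 2 - ‖z - w‖ ^ 2 / 4 := by
    intro n
    have e : u n - (2 : ℝ)⁻¹ • (z + w) = ((1 : ℝ) - 2⁻¹) • (u n - z) + (2 : ℝ)⁻¹ • (u n - w) := by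
      module
    have e2 : u n - z - (u n - w) = w - z := by abel
    rw [e, KrasnoselskijIteration.norm_sq_convex_combination, e2, norm_sub_rev w z]
    ring
  refine limsup_le_of_forall_eventually_le_add (L := 0) (fun _ => sq_nonneg _) fun ε hε => ?_
  filter_upwards [eventually_norm_sub_sq_le hu z (half_pos hε),
    eventually_norm_sub_sq_le hu w (half_pos hε)] with n h1 h2
  rw [hpt n]
  linarith

omit [InnerProductSpace ℝ E] in
/-- Local Lipschitz estimate: `r_u(z) ≤ r_u(w) + (2R + ‖z‖ + ‖w‖) ‖z − w‖` ([GK90, Ch. 9,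
property (b)] is the 1-Lipschitz bound for the un-squared radius).
[cite: GoebelKirk1990, Ch. 9, (9.1) property (b)] -/
theorem asymRadiusSq_le_add_mul (hu : ∀ n, ‖u n‖ ≤ R) (z w : E) :
    asymRadiusSq u z ≤ asymRadiusSq u w + (2 * R + ‖z‖ + ‖w‖) * ‖z - w‖ := by
  have hpt : ∀ n, ‖u n - z‖ ^ 2 ≤ ‖u n - w‖ ^ 2 + (2 * R + ‖z‖ + ‖w‖) * ‖z - w‖ := by
    intro n
    have h1 : ‖u n - z‖ ≤ ‖u n - w‖ + ‖z - w‖ := by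
      have := norm_sub_le (u n - w) (z - w)
      rwa [sub_sub_sub_cancel_right] at this
    have hz : ‖u n - z‖ ≤ R + ‖z‖ := (norm_sub_le _ _).trans (add_le_add (hu n) le_rfl)
    have hw : ‖u n - w‖ ≤ R + ‖w‖ := (norm_sub_le _ _).trans (add_le_add (hu n) le_rfl)
    have s1 : ‖u n - z‖ ^ 2 - ‖u n - w‖ ^ 2 =
        (‖u n - z‖ - ‖u n - w‖) * (‖u n - z‖ + ‖u n - w‖) := by ring
    have s2 : (‖u n - z‖ - ‖u n - w‖) * (‖u n - z‖ + ‖u n - w‖) ≤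
        ‖z - w‖ * (‖u n - z‖ + ‖u n - w‖) :=
      mul_le_mul_of_nonneg_right (by linarith) (by positivity)
    have s3 : ‖z - w‖ * (‖u n - z‖ + ‖u n - w‖) ≤ ‖z - w‖ * (2 * R + ‖z‖ + ‖w‖) :=
      mul_le_mul_of_nonneg_left (by linarith) (norm_nonneg _)
    linarith
  refine limsup_le_of_forall_eventually_le_add (L := 0) (fun _ => sq_nonneg _) fun ε hε => ?_
  filter_upwards [eventually_norm_sub_sq_le hu w hε] with n hn
  linarith [hpt n]

omit [InnerProductSpace ℝ E] in
/-- The asymptotic radius functional is continuous ([GK90, Ch. 9]: "`r(x, {x_n})` is a nonnegative,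
continuous, and convex function of `x`"). [cite: GoebelKirk1990, Ch. 9, (9.1) properties (b)–(d)] -/
theorem continuous_asymRadiusSq (hu : ∀ n, ‖u n‖ ≤ R) : Continuous (asymRadiusSq u) := by
  refine continuous_iff_continuousAt.2 fun z => ?_
  rw [ContinuousAt, tendsto_iff_norm_sub_tendsto_zero]
  have hb : ∀ w, ‖asymRadiusSq u w - asymRadiusSq u z‖ ≤ (2 * R + ‖w‖ + ‖z‖) * ‖w - z‖ := by
    intro w
    rw [Real.norm_eq_abs, abs_sub_le_iff]
    constructor
    · have := asymRadiusSq_le_add_mul hu w z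
      linarith
    · have := asymRadiusSq_le_add_mul hu z w
      rw [norm_sub_rev z w] at this
      linarith
  refine squeeze_zero (fun w => norm_nonneg _) hb ?_
  have hc : Continuous fun w : E => (2 * R + ‖w‖ + ‖z‖) * ‖w - z‖ := by fun_prop
  simpa using hc.tendsto z

omit [InnerProductSpace ℝ E] in
/-- **[GK90, Lemma 9.3]**: along a bounded approximate fixed point sequence (`‖u_n − T u_n‖ → 0`)
of a nonexpansive `T`, `r_u(T c) ≤ r_u(c)` for every `c`.
[cite: GoebelKirk1990, Ch. 9, Lemma 9.3] -/
theorem asymRadiusSq_apply_le {T : E → E} (hT : ∀ x y, ‖T x - T y‖ ≤ ‖x - y‖)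
    (hu : ∀ n, ‖u n‖ ≤ R) (hres : Tendsto (fun n => ‖u n - T (u n)‖) atTop (𝓝 0)) (c : E) :
    asymRadiusSq u (T c) ≤ asymRadiusSq u c := by
  have hpt : ∀ n, ‖u n - T c‖ ^ 2 ≤
      ‖u n - c‖ ^ 2 + ‖u n - T (u n)‖ * (‖u n - T (u n)‖ + 2 * (R + ‖c‖)) := by
    intro n
    have h1 : ‖u n - T c‖ ≤ ‖u n - T (u n)‖ + ‖u n - c‖ :=
      calc ‖u n - T c‖ = ‖(u n - T (u n)) + (T (u n) - T c)‖ := by rw [sub_add_sub_cancel]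
        _ ≤ ‖u n - T (u n)‖ + ‖T (u n) - T c‖ := norm_add_le _ _
        _ ≤ ‖u n - T (u n)‖ + ‖u n - c‖ := add_le_add le_rfl (hT _ _)
    have hc' : ‖u n - c‖ ≤ R + ‖c‖ := (norm_sub_le _ _).trans (add_le_add (hu n) le_rfl)
    have hd : 0 ≤ ‖u n - T (u n)‖ := norm_nonneg _
    have s1 : ‖u n - T c‖ ^ 2 ≤ (‖u n - T (u n)‖ + ‖u n - c‖) ^ 2 :=
      pow_le_pow_left₀ (norm_nonneg _) h1 2
    have s2 : ‖u n - T (u n)‖ * ‖u n - c‖ ≤ ‖u n - T (u n)‖ * (R + ‖c‖) :=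
      mul_le_mul_of_nonneg_left hc' hd
    nlinarith [s1, s2]
  have he : Tendsto (fun n => ‖u n - T (u n)‖ * (‖u n - T (u n)‖ + 2 * (R + ‖c‖))) atTop
      (𝓝 0) := by
    simpa using hres.mul (hres.add (tendsto_const_nhds (x := 2 * (R + ‖c‖))))
  exact limsup_le_limsup_of_le_add (fun _ => sq_nonneg _) (norm_sub_sq_le_bound hu c) he
    (Eventually.of_forall hpt)

/-! ## Existence, uniqueness and the fixed-point property of the asymptotic centre -/

/-- **Existence of the asymptotic centre** in a real Hilbert space ([Ede72, Thm 1] in uniformly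
convex spaces; [Ber07, Def 6.5] "the unique point"): a minimising sequence of the strongly convex
functional `r_u` is Cauchy, and `r_u` is continuous. No weak compactness is used.
[cite: Edelstein1972, Thm 1] [cite: Berinde2007, Ch. 6 §6.3, Def 6.5] -/
theorem exists_isAsymCenter [CompleteSpace E] (hu : ∀ n, ‖u n‖ ≤ R) : ∃ c, IsAsymCenter u c := by
  set r := asymRadiusSq u with hr
  have hr0 : ∀ z, 0 ≤ r z := asymRadiusSq_nonneg hu
  have hbdd : BddBelow (Set.range r) := ⟨0, by rintro _ ⟨z, rfl⟩; exact hr0 z⟩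
  set m := ⨅ z, r z with hm
  have hm_le : ∀ z, m ≤ r z := fun z => ciInf_le hbdd z
  have hex : ∀ k : ℕ, ∃ z, r z < m + 1 / ((k : ℝ) + 1) := fun k =>
    exists_lt_of_ciInf_lt (lt_add_of_pos_right _ (by positivity))
  choose z hz using hex
  have hgap : ∀ j k, ‖z j - z k‖ ^ 2 ≤ 2 * (r (z j) - m) + 2 * (r (z k) - m) := by
    intro j k
    have h1 := asymRadiusSq_midpoint_le hu (z j) (z k)
    have h2 := hm_le ((2 : ℝ)⁻¹ • (z j + z k))
    linarith
  have hcauchy : CauchySeq z := by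
    refine Metric.cauchySeq_iff.2 fun ε hε => ?_
    obtain ⟨N, hN⟩ := exists_nat_gt (4 / ε ^ 2)
    refine ⟨N, fun j hj k hk => ?_⟩
    rw [dist_eq_norm]
    have hNj : (1 : ℝ) / ((j : ℝ) + 1) ≤ 1 / ((N : ℝ) + 1) :=
      one_div_le_one_div_of_le (by positivity) (by exact_mod_cast Nat.succ_le_succ hj)
    have hNk : (1 : ℝ) / ((k : ℝ) + 1) ≤ 1 / ((N : ℝ) + 1) :=
      one_div_le_one_div_of_le (by positivity) (by exact_mod_cast Nat.succ_le_succ hk)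
    have h4 : 4 / ((N : ℝ) + 1) < ε ^ 2 := by
      rw [div_lt_iff₀ (by positivity)]
      have := (div_lt_iff₀ (by positivity : (0 : ℝ) < ε ^ 2)).1 hN
      nlinarith
    have hsq : ‖z j - z k‖ ^ 2 < ε ^ 2 := by
      have := hgap j k
      have hj' := hz j
      have hk' := hz k
      have : 2 * (r (z j) - m) + 2 * (r (z k) - m) < 4 / ((N : ℝ) + 1) := by
        have e4 : (4 : ℝ) / ((N : ℝ) + 1) = 2 * (1 / ((N : ℝ) + 1)) + 2 * (1 / ((N : ℝ) + 1)) := by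
          ring
        rw [e4]
        linarith
      linarith
    exact lt_of_pow_lt_pow_left₀ 2 hε.le hsq
  obtain ⟨c, hc⟩ := cauchySeq_tendsto_of_complete hcauchy
  have hrc : Tendsto (fun k => r (z k)) atTop (𝓝 (r c)) :=
    ((continuous_asymRadiusSq hu).tendsto c).comp hc
  have hrm : Tendsto (fun k => r (z k)) atTop (𝓝 m) := by
    have h1 : Tendsto (fun k : ℕ => m + 1 / ((k : ℝ) + 1)) atTop (𝓝 m) := by
      simpa using (tendsto_const_nhds (x := m)).add tendsto_one_div_add_atTop_nhds_zero_nat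
    exact tendsto_of_tendsto_of_tendsto_of_le_of_le tendsto_const_nhds h1
      (fun k => hm_le (z k)) (fun k => (hz k).le)
  have heq : r c = m := tendsto_nhds_unique hrc hrm
  exact ⟨c, fun w => heq.le.trans (hm_le w)⟩

/-- **Growth away from the centre**: if `c` is an asymptotic centre then
`‖z − c‖² ≤ 2 (r_u(z) − r_u(c))` for every `z` (from the midpoint inequality).
[cite: Edelstein1972, Thm 1] [cite: GoebelKirk1990, Ch. 9, Thm 9.2] -/
theorem IsAsymCenter.norm_sub_sq_le (hc : IsAsymCenter u c) (hu : ∀ n, ‖u n‖ ≤ R) (z : E) :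
    ‖z - c‖ ^ 2 ≤ 2 * (asymRadiusSq u z - asymRadiusSq u c) := by
  have h1 := asymRadiusSq_midpoint_le hu c z
  have h2 := hc ((2 : ℝ)⁻¹ • (c + z))
  rw [norm_sub_rev z c]
  linarith

omit [InnerProductSpace ℝ E] in
/-- From `‖v‖² ≤ 0` to `v = 0`. [folklore] -/
private theorem eq_of_norm_sub_sq_le_zero {a b : E} (h : ‖a - b‖ ^ 2 ≤ 0) : a = b := by
  have h3 : ‖a - b‖ ^ 2 = 0 := le_antisymm h (sq_nonneg _)
  exact sub_eq_zero.1 (norm_eq_zero.1 ((pow_eq_zero_iff two_ne_zero).1 h3))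

/-- **Uniqueness of the asymptotic centre** in Hilbert space ([Ede72]; [Ber07, Def 6.5] "the unique
point"). [cite: Edelstein1972, Thm 1] [cite: Berinde2007, Ch. 6 §6.3, Def 6.5] -/
theorem IsAsymCenter.unique (hc : IsAsymCenter u c) (hc' : IsAsymCenter u c')
    (hu : ∀ n, ‖u n‖ ≤ R) : c = c' := by
  have h := hc'.norm_sub_sq_le hu c
  have h2 := hc c'
  exact eq_of_norm_sub_sq_le_zero (by linarith)

/-- **Edelstein's fixed-point property** ([Ede72]; [GK90, Lemma 9.3]): the asymptotic centre of a
bounded approximate fixed point sequence (`‖u_n − T u_n‖ → 0`) of a nonexpansive map `T` is a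
fixed point of `T`. [cite: Edelstein1972, Thm 2] [cite: GoebelKirk1990, Ch. 9, Lemma 9.3] -/
theorem IsAsymCenter.apply_eq {T : E → E} (hc : IsAsymCenter u c) (hu : ∀ n, ‖u n‖ ≤ R)
    (hT : ∀ x y, ‖T x - T y‖ ≤ ‖x - y‖)
    (hres : Tendsto (fun n => ‖u n - T (u n)‖) atTop (𝓝 0)) : T c = c := by
  have h1 := hc.norm_sub_sq_le hu (T c)
  have h2 := asymRadiusSq_apply_le hT hu hres c
  exact eq_of_norm_sub_sq_le_zero (by linarith)

/-- The asymptotic centre of a sequence lying in a closed convex set `K` belongs to `K` (because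
`‖u_n − P_K c‖ ≤ ‖u_n − c‖` for `u_n ∈ K`; [GK90, (9.2)–(9.3)] take the centre relative to `K`).
[cite: GoebelKirk1990, Ch. 9, (9.2)–(9.3)] -/
theorem IsAsymCenter.mem_of_forall_mem [CompleteSpace E] {K : Set E} (hc : IsAsymCenter u c)
    (hu : ∀ n, ‖u n‖ ≤ R) (hK : Convex ℝ K) (hKcl : IsClosed K) (hmem : ∀ n, u n ∈ K) :
    c ∈ K := by
  have hne : K.Nonempty := ⟨u 0, hmem 0⟩
  have hKc : IsComplete K := hKcl.isComplete
  have hpt : ∀ n, ‖u n - ConvexMetricProjection.proj K c‖ ^ 2 ≤ ‖u n - c‖ ^ 2 + 0 := by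
    intro n
    have h := ConvexMetricProjection.norm_proj_sub_proj_sq_add_le hne hKc hK c (u n)
    rw [ConvexMetricProjection.proj_eq_self hne hKc hK (hmem n)] at h
    rw [norm_sub_rev (u n), norm_sub_rev (u n) c, add_zero]
    nlinarith [sq_nonneg ‖c - ConvexMetricProjection.proj K c - (u n - u n)‖]
  have h1 : asymRadiusSq u (ConvexMetricProjection.proj K c) ≤ asymRadiusSq u c :=
    limsup_le_limsup_of_le_add (fun _ => sq_nonneg _) (norm_sub_sq_le_bound hu c)
      tendsto_const_nhds (Eventually.of_forall hpt)
  have h2 := hc.norm_sub_sq_le hu (ConvexMetricProjection.proj K c)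
  have h4 : ConvexMetricProjection.proj K c = c := eq_of_norm_sub_sq_le_zero (by linarith)
  rw [← h4]
  exact ConvexMetricProjection.proj_mem hne hKc hK c

/-! ## Opial's lemma and the demiclosedness principle (Hilbert space, sequential, no compactness) -/

/-- **Opial's identity in Hilbert space**: if `u_n ⇀ q` (bounded sequence) then
`r_u(z) = r_u(q) + ‖z − q‖²` for every `z` — the computation (5) in the proof of [Ber07, Thm 3.3].
[cite: Berinde2007, Ch. 3 §3.1, Thm 3.3 (proof, (5))] [cite: Opial1967, Lemma 1] -/
theorem asymRadiusSq_eq_add_of_weak_tendsto (hu : ∀ n, ‖u n‖ ≤ R)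
    (hw : ∀ y : E, Tendsto (fun n => ⟪y, u n⟫) atTop (𝓝 ⟪y, q⟫)) (z : E) :
    asymRadiusSq u z = asymRadiusSq u q + ‖z - q‖ ^ 2 := by
  have hpt : ∀ n, ‖u n - z‖ ^ 2 = ‖u n - q‖ ^ 2 + ‖z - q‖ ^ 2 + 2 * ⟪q - z, u n - q⟫ := by
    intro n
    have e : u n - z = (u n - q) + (q - z) := by abel
    rw [e, norm_add_sq_real, norm_sub_rev z q, real_inner_comm]
    ring
  have he : Tendsto (fun n => 2 * ⟪q - z, u n - q⟫) atTop (𝓝 0) := by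
    have h1 := ((hw (q - z)).sub (tendsto_const_nhds (x := ⟪q - z, q⟫))).const_mul 2
    rw [sub_self, mul_zero] at h1
    refine h1.congr fun n => ?_
    rw [inner_sub_right]
  apply le_antisymm
  · refine limsup_le_of_forall_eventually_le_add (L := 0) (fun _ => sq_nonneg _) fun ε hε => ?_
    have h2 : ∀ᶠ n in atTop, 2 * ⟪q - z, u n - q⟫ < ε / 2 :=
      he.eventually (gt_mem_nhds (by linarith))
    filter_upwards [eventually_norm_sub_sq_le hu q (half_pos hε), h2] with n h1 h2
    rw [hpt n]
    linarith
  · rw [← le_sub_iff_add_le]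
    refine limsup_le_of_forall_eventually_le_add (L := 0) (fun _ => sq_nonneg _) fun ε hε => ?_
    have h2 : ∀ᶠ n in atTop, -(ε / 2) < 2 * ⟪q - z, u n - q⟫ :=
      he.eventually (lt_mem_nhds (by linarith))
    filter_upwards [eventually_norm_sub_sq_le hu z (half_pos hε), h2] with n h1 h2
    linarith [hpt n]

/-- **The weak limit is the asymptotic centre** ([GK90, Ch. 9]: "the asymptotic center of a weakly
convergent sequence in `l^p` coincides with its weak limit"; Hilbert case).
[cite: GoebelKirk1990, Ch. 9, Example after Thm 9.2] [cite: Opial1967, Lemma 1] -/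
theorem isAsymCenter_of_weak_tendsto (hu : ∀ n, ‖u n‖ ≤ R)
    (hw : ∀ y : E, Tendsto (fun n => ⟪y, u n⟫) atTop (𝓝 ⟪y, q⟫)) : IsAsymCenter u q := by
  intro z
  rw [asymRadiusSq_eq_add_of_weak_tendsto hu hw z]
  exact le_add_of_nonneg_right (sq_nonneg _)

/-- **Opial's condition holds in every Hilbert space** ([Ber07, Exercise 3.18]; [Op67a]): if
`u_n ⇀ q` then `limsup ‖u_n − q‖² < limsup ‖u_n − z‖²` for every `z ≠ q`.
[cite: Berinde2007, Ch. 3, Exercise 3.18] [cite: Opial1967, Lemma 1] -/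
theorem asymRadiusSq_lt_of_weak_tendsto (hu : ∀ n, ‖u n‖ ≤ R)
    (hw : ∀ y : E, Tendsto (fun n => ⟪y, u n⟫) atTop (𝓝 ⟪y, q⟫)) (hz : z ≠ q) :
    asymRadiusSq u q < asymRadiusSq u z := by
  rw [asymRadiusSq_eq_add_of_weak_tendsto hu hw z]
  have : 0 < ‖z - q‖ ^ 2 := pow_pos (norm_pos_iff.2 (sub_ne_zero.2 hz)) 2
  linarith

/-- **Demiclosedness principle** (`I − T` is demiclosed at `0` for nonexpansive `T`, [Ber07,
Def 4.2 and Remark 2 after Thm 4.7], after [Op67a]), sequential Hilbert-space form with no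
compactness: `u_n ⇀ q` and `‖u_n − T u_n‖ → 0` imply `T q = q`.
[cite: Berinde2007, Ch. 4 §4.1, Remark 2 after Thm 4.7] [cite: Opial1967, Lemma 2] -/
theorem apply_eq_of_weak_tendsto {T : E → E} (hT : ∀ x y, ‖T x - T y‖ ≤ ‖x - y‖)
    (hu : ∀ n, ‖u n‖ ≤ R) (hw : ∀ y : E, Tendsto (fun n => ⟪y, u n⟫) atTop (𝓝 ⟪y, q⟫))
    (hres : Tendsto (fun n => ‖u n - T (u n)‖) atTop (𝓝 0)) : T q = q :=
  (isAsymCenter_of_weak_tendsto hu hw).apply_eq hu hT hres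

/-! ## The weak convergence principle -/

/-- **Weak convergence principle** (the common core of [Ber07, Thms 3.3–3.4] = [BrP67, Thms 7–8],
[Ber07, Exercise 3.19] and [Op67a]): in a real Hilbert space let `T` be nonexpansive and let `x_n`
be a bounded sequence with `‖x_n − T x_n‖ → 0` which is Fejér monotone with respect to `Fix T`
(`‖x_{n+1} − p‖ ≤ ‖x_n − p‖` whenever `T p = p`). Then `x_n` converges weakly to a fixed point of
`T`, namely to the asymptotic centre of `(x_n)`. Proof by asymptotic centres and Bolzano–Weierstrass
in `ℝ` only (see the module docstring, "Proof route").
[cite: Berinde2007, Ch. 3 §3.1, Thm 3.4] [cite: BrowderPetryshyn1967, Thm 8]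
[cite: Edelstein1972, Thm 2] -/
theorem exists_fixedPoint_weak_tendsto [CompleteSpace E] {T : E → E} {x : ℕ → E}
    (hT : ∀ a b, ‖T a - T b‖ ≤ ‖a - b‖) (hbdd : ∀ n, ‖x n‖ ≤ R)
    (hres : Tendsto (fun n => ‖x n - T (x n)‖) atTop (𝓝 0))
    (hfejer : ∀ p, T p = p → ∀ n, ‖x (n + 1) - p‖ ≤ ‖x n - p‖) :
    ∃ p, T p = p ∧ IsAsymCenter x p ∧ ∀ y : E, Tendsto (fun n => ⟪y, x n⟫) atTop (𝓝 ⟪y, p⟫) := by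
  obtain ⟨c, hc⟩ := exists_isAsymCenter hbdd
  have hTc : T c = c := hc.apply_eq hbdd hT hres
  refine ⟨c, hTc, hc, ?_⟩
  -- for every fixed point the distances converge (Fejér monotone and bounded below)
  have hconv : ∀ p, T p = p → ∃ ℓ : ℝ, Tendsto (fun n => ‖x n - p‖) atTop (𝓝 ℓ) := fun p hp =>
    ⟨_, tendsto_atTop_ciInf (antitone_nat_of_succ_le fun n => hfejer p hp n)
      ⟨0, by rintro _ ⟨n, rfl⟩; exact norm_nonneg _⟩⟩
  obtain ⟨ℓ, hℓ⟩ := hconv c hTc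
  intro y
  by_contra hnot
  -- Step 1: a subsequence along which `⟪y, x_n − c⟫` stays `ε` away from `0`
  have h1 : ∃ ε > 0, ∃ᶠ n in atTop, ε ≤ |⟪y, x n⟫ - ⟪y, c⟫| := by
    rw [Metric.tendsto_atTop] at hnot
    push Not at hnot
    obtain ⟨ε, hε, hN⟩ := hnot
    refine ⟨ε, hε, Filter.frequently_atTop.2 fun N => ?_⟩
    obtain ⟨n, hn, hd⟩ := hN N
    exact ⟨n, hn, by rwa [Real.dist_eq] at hd⟩
  obtain ⟨ε, hε, hfreq⟩ := h1
  obtain ⟨φ, hφ, hφP⟩ := extraction_of_frequently_atTop hfreq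
  -- Step 2: Bolzano–Weierstrass in `ℝ` for the bounded real sequence `s_k = ⟪y, x_{φ k} − c⟫`
  set s : ℕ → ℝ := fun k => ⟪y, x (φ k) - c⟫ with hs
  have hsb : ∀ k, |s k| ≤ ‖y‖ * (R + ‖c‖) := fun k =>
    (abs_real_inner_le_norm _ _).trans (mul_le_mul_of_nonneg_left
      ((norm_sub_le _ _).trans (add_le_add (hbdd _) le_rfl)) (norm_nonneg _))
  obtain ⟨σ, -, ψ, hψ, hσ⟩ := tendsto_subseq_of_bounded (Metric.isBounded_Icc
    (-(‖y‖ * (R + ‖c‖))) (‖y‖ * (R + ‖c‖))) (fun k => Set.mem_Icc.2 (abs_le.1 (hsb k)))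
  have hσε : ε ≤ |σ| := by
    refine ge_of_tendsto ((continuous_abs.tendsto σ).comp hσ) (Eventually.of_forall fun k => ?_)
    have := hφP (ψ k)
    simp only [Function.comp_apply, hs, inner_sub_right]
    exact this
  have hσ0 : σ ≠ 0 := by
    intro h
    rw [h, abs_zero] at hσε
    linarith
  have hy0 : y ≠ 0 := by
    rintro rfl
    apply hσ0
    have h0 : Tendsto (s ∘ ψ) atTop (𝓝 0) := by
      simp only [hs, Function.comp_def, inner_zero_left]
      exact tendsto_const_nhds
    exact tendsto_nhds_unique hσ h0
  -- Step 3: the sub-subsequence `v = x ∘ φ ∘ ψ` has the SAME asymptotic centre `c`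
  have hχm : StrictMono (φ ∘ ψ) := hφ.comp hψ
  set v : ℕ → E := x ∘ (φ ∘ ψ) with hv
  have hvb : ∀ k, ‖v k‖ ≤ R := fun k => hbdd _
  have hvres : Tendsto (fun k => ‖v k - T (v k)‖) atTop (𝓝 0) := hres.comp hχm.tendsto_atTop
  have hvℓ : Tendsto (fun k => ‖v k - c‖) atTop (𝓝 ℓ) := hℓ.comp hχm.tendsto_atTop
  have hvc : IsAsymCenter v c := by
    intro z
    obtain ⟨c', hc'⟩ := exists_isAsymCenter hvb
    have hTc' : T c' = c' := hc'.apply_eq hvb hT hvres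
    obtain ⟨ℓ', hℓ'⟩ := hconv c' hTc'
    have e1 : asymRadiusSq v c = ℓ ^ 2 := asymRadiusSq_eq_of_tendsto hvℓ
    have e2 : asymRadiusSq x c = ℓ ^ 2 := asymRadiusSq_eq_of_tendsto hℓ
    have e3 : asymRadiusSq v c' = ℓ' ^ 2 :=
      asymRadiusSq_eq_of_tendsto (hℓ'.comp hχm.tendsto_atTop)
    have e4 : asymRadiusSq x c' = ℓ' ^ 2 := asymRadiusSq_eq_of_tendsto hℓ'
    have h5 := hc c'
    have h6 := hc' z
    linarith
  -- Step 4: the radius of `v` at `c + t y` is a limit, and it undercuts `r_v(c)` for `t = σ/‖y‖²`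
  have hσ' : Tendsto (fun k => ⟪y, v k - c⟫) atTop (𝓝 σ) := hσ
  set t : ℝ := σ / ‖y‖ ^ 2 with ht
  have hsq : Tendsto (fun k => ‖v k - (c + t • y)‖ ^ 2) atTop
      (𝓝 (ℓ ^ 2 - 2 * t * σ + t ^ 2 * ‖y‖ ^ 2)) := by
    have h3 := ((hvℓ.pow 2).sub (hσ'.const_mul (2 * t))).add
      (tendsto_const_nhds (x := t ^ 2 * ‖y‖ ^ 2))
    refine h3.congr fun k => ?_
    have e : v k - (c + t • y) = (v k - c) - t • y := by abel
    have e2 : ‖v k - (c + t • y)‖ ^ 2 =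
        ‖v k - c‖ ^ 2 - 2 * t * ⟪y, v k - c⟫ + t ^ 2 * ‖y‖ ^ 2 := by
      rw [e, norm_sub_sq_real (v k - c) (t • y), real_inner_smul_right, norm_smul,
        Real.norm_eq_abs, mul_pow, sq_abs, ← real_inner_comm (v k - c) y]
      ring
    rw [e2]
  have hr : asymRadiusSq v (c + t • y) = ℓ ^ 2 - 2 * t * σ + t ^ 2 * ‖y‖ ^ 2 := hsq.limsup_eq
  have hrc : asymRadiusSq v c = ℓ ^ 2 := asymRadiusSq_eq_of_tendsto hvℓ
  have hg := hvc.norm_sub_sq_le hvb (c + t • y)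
  rw [add_sub_cancel_left, norm_smul, mul_pow, Real.norm_eq_abs, sq_abs, hr, hrc] at hg
  have hy2 : 0 < ‖y‖ ^ 2 := pow_pos (norm_pos_iff.2 hy0) 2
  have hσ2 : 0 < σ * σ := mul_self_pos.2 hσ0
  have key : t ^ 2 * ‖y‖ ^ 2 - 4 * t * σ = -(3 * (σ * σ) / ‖y‖ ^ 2) := by
    rw [ht]
    field_simp
    ring
  have hneg : 0 < 3 * (σ * σ) / ‖y‖ ^ 2 := div_pos (by linarith) hy2
  linarith

/-! ## Berinde's Theorems 3.3 and 3.4 (Browder–Petryshyn) -/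

section Krasnoselskij

open Literature.Analysis.Convex.KrasnoselskijIteration

variable [CompleteSpace E] {T : E → E} {t : ℝ} {x₀ p : E}

/-- **[Ber07, Thm 3.4] = [BrP67, Thm 8], whole-space form**: `T : E → E` nonexpansive on a real
Hilbert space with a fixed point, `0 < λ < 1`. Then for every `x₀` the Krasnoselskij iteration
`x_{n+1} = (1 − λ) x_n + λ T x_n` converges weakly to a fixed point `q` of `T`, and `q` is the
asymptotic centre of `(x_n)` (Fejér monotonicity and asymptotic regularity are [Ber07, Thm 3.2],
from the tree). [cite: Berinde2007, Ch. 3 §3.1, Thm 3.4] [cite: BrowderPetryshyn1967, Thm 8] -/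
theorem kmIter_weak_tendsto (hT : ∀ x y, ‖T x - T y‖ ≤ ‖x - y‖) (hp : T p = p) (ht0 : 0 < t)
    (ht1 : t < 1) (x₀ : E) :
    ∃ q, T q = q ∧ IsAsymCenter (kmIter T t x₀) q ∧
      ∀ y : E, Tendsto (fun n => ⟪y, kmIter T t x₀ n⟫) atTop (𝓝 ⟪y, q⟫) := by
  have hb : ∀ n, ‖kmIter T t x₀ n‖ ≤ ‖x₀ - p‖ + ‖p‖ := fun n =>
    calc ‖kmIter T t x₀ n‖ = ‖(kmIter T t x₀ n - p) + p‖ := by rw [sub_add_cancel]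
      _ ≤ ‖kmIter T t x₀ n - p‖ + ‖p‖ := norm_add_le _ _
      _ ≤ ‖x₀ - p‖ + ‖p‖ := add_le_add (norm_kmIter_sub_le hT hp ht0.le ht1.le n) le_rfl
  exact exists_fixedPoint_weak_tendsto hT hb (tendsto_norm_kmIter_sub_apply hT hp ht0 ht1)
    fun q hq n => norm_kmIter_succ_sub_le hT hq ht0.le ht1.le n

/-- **[Ber07, Thm 3.4], `WeakSpace` form**: the Krasnoselskij iterates converge to a fixed point in
the weak topology of `E`. [cite: Berinde2007, Ch. 3 §3.1, Thm 3.4]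
[cite: BrowderPetryshyn1967, Thm 8] -/
theorem kmIter_tendsto_toWeakSpace (hT : ∀ x y, ‖T x - T y‖ ≤ ‖x - y‖) (hp : T p = p)
    (ht0 : 0 < t) (ht1 : t < 1) (x₀ : E) :
    ∃ q, T q = q ∧
      Tendsto (fun n => toWeakSpace ℝ E (kmIter T t x₀ n)) atTop (𝓝 (toWeakSpace ℝ E q)) := by
  obtain ⟨q, hq, -, hw⟩ := kmIter_weak_tendsto hT hp ht0 ht1 x₀
  exact ⟨q, hq, tendsto_toWeakSpace_of_forall_inner hw⟩

/-- The nonexpansive extension `T ∘ P_C` of a map nonexpansive on a closed convex `C`: it is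
nonexpansive on `E` (because `P_C` is, [Deu01, Thm 5.5]) and agrees with `T` on `C`. [folklore] -/
private theorem norm_comp_proj_sub_le {C : Set E} (hCconv : Convex ℝ C) (hCcl : IsClosed C)
    (hCne : C.Nonempty) (hT : ∀ x ∈ C, ∀ y ∈ C, ‖T x - T y‖ ≤ ‖x - y‖) (x y : E) :
    ‖T (ConvexMetricProjection.proj C x) - T (ConvexMetricProjection.proj C y)‖ ≤ ‖x - y‖ :=
  (hT _ (ConvexMetricProjection.proj_mem hCne hCcl.isComplete hCconv x) _
    (ConvexMetricProjection.proj_mem hCne hCcl.isComplete hCconv y)).trans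
    (ConvexMetricProjection.norm_proj_sub_proj_le hCne hCcl.isComplete hCconv x y)

omit [CompleteSpace E] in
/-- The Krasnoselskij iterates of a self-map of a convex `C` started in `C` stay in `C`, and they do
not see the values of the map off `C`: for `S = T` on `C`, `kmIter S = kmIter T` along the orbit.
[cite: Berinde2007, Ch. 3 §3.1, Thm 3.4 ("for any `x₀` in `C`")] -/
theorem kmIter_mem_and_eq {C : Set E} {S : E → E} (hCconv : Convex ℝ C) (hmaps : Set.MapsTo T C C)
    (hS : ∀ x ∈ C, S x = T x) (hx₀ : x₀ ∈ C) (ht0 : 0 ≤ t) (ht1 : t ≤ 1) (n : ℕ) :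
    kmIter T t x₀ n ∈ C ∧ kmIter S t x₀ n = kmIter T t x₀ n := by
  induction n with
  | zero => exact ⟨by simpa using hx₀, by simp⟩
  | succ n ih =>
    obtain ⟨hmem, heq⟩ := ih
    refine ⟨?_, ?_⟩
    · rw [kmIter_succ, averagedMap]
      exact hCconv hmem (hmaps hmem) (by linarith) ht0 (by ring)
    · rw [kmIter_succ, kmIter_succ, heq, averagedMap, averagedMap, hS _ hmem]

/-- **[Ber07, Thm 3.4] = [BrP67, Thm 8] as printed**: `C` a bounded closed convex subset of a real
Hilbert space, `T : C → C` nonexpansive, `0 < λ < 1`. Then for every `x₀ ∈ C` the Krasnoselskij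
iteration stays in `C` and converges weakly to a fixed point `q ∈ C` of `T` (the fixed point needed
to run the Fejér argument comes from Browder's theorem [Ber07, Thm 3.1], here the tree's
`BrowderCurveStrongConvergence.exists_fixedPoint_of_nonexpansiveOn`).
[cite: Berinde2007, Ch. 3 §3.1, Thm 3.4] [cite: BrowderPetryshyn1967, Thm 8] -/
theorem kmIter_weak_tendsto_of_mapsTo {C : Set E} (hCconv : Convex ℝ C) (hCcl : IsClosed C)
    (hCbd : Bornology.IsBounded C) (hT : ∀ x ∈ C, ∀ y ∈ C, ‖T x - T y‖ ≤ ‖x - y‖)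
    (hmaps : Set.MapsTo T C C) (hx₀ : x₀ ∈ C) (ht0 : 0 < t) (ht1 : t < 1) :
    ∃ q ∈ C, T q = q ∧ (∀ n, kmIter T t x₀ n ∈ C) ∧ IsAsymCenter (kmIter T t x₀) q ∧
      ∀ y : E, Tendsto (fun n => ⟪y, kmIter T t x₀ n⟫) atTop (𝓝 ⟪y, q⟫) := by
  have hCne : C.Nonempty := ⟨x₀, hx₀⟩
  set S : E → E := T ∘ ConvexMetricProjection.proj C with hSdef
  have hS : ∀ x y, ‖S x - S y‖ ≤ ‖x - y‖ := norm_comp_proj_sub_le hCconv hCcl hCne hT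
  have hSC : ∀ x ∈ C, S x = T x := fun x hx => by
    simp only [hSdef, Function.comp_apply,
      ConvexMetricProjection.proj_eq_self hCne hCcl.isComplete hCconv hx]
  obtain ⟨p, hpC, hp⟩ :=
    BrowderCurveStrongConvergence.exists_fixedPoint_of_nonexpansiveOn hCconv hCcl hCbd hCne hT hmaps
  have hSp : S p = p := by rw [hSC p hpC, hp]
  have horbit := fun n => kmIter_mem_and_eq hCconv hmaps hSC hx₀ ht0.le ht1.le n
  have heq : kmIter S t x₀ = kmIter T t x₀ := funext fun n => (horbit n).2
  obtain ⟨q, hSq, hqc, hw⟩ := kmIter_weak_tendsto hS hSp ht0 ht1 x₀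
  rw [heq] at hqc hw
  have hb : ∀ n, ‖kmIter T t x₀ n‖ ≤ ‖x₀ - p‖ + ‖p‖ := fun n => by
    rw [← heq]
    calc ‖kmIter S t x₀ n‖ = ‖(kmIter S t x₀ n - p) + p‖ := by rw [sub_add_cancel]
      _ ≤ ‖kmIter S t x₀ n - p‖ + ‖p‖ := norm_add_le _ _
      _ ≤ ‖x₀ - p‖ + ‖p‖ := add_le_add (norm_kmIter_sub_le hS hSp ht0.le ht1.le n) le_rfl
  have hqC : q ∈ C := hqc.mem_of_forall_mem hb hCconv hCcl fun n => (horbit n).1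
  refine ⟨q, hqC, ?_, fun n => (horbit n).1, hqc, hw⟩
  rw [← hSC q hqC, hSq]

/-- **[Ber07, Thm 3.4] as printed, `WeakSpace` form**. [cite: Berinde2007, Ch. 3 §3.1, Thm 3.4]
[cite: BrowderPetryshyn1967, Thm 8] -/
theorem kmIter_tendsto_toWeakSpace_of_mapsTo {C : Set E} (hCconv : Convex ℝ C)
    (hCcl : IsClosed C) (hCbd : Bornology.IsBounded C)
    (hT : ∀ x ∈ C, ∀ y ∈ C, ‖T x - T y‖ ≤ ‖x - y‖) (hmaps : Set.MapsTo T C C) (hx₀ : x₀ ∈ C)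
    (ht0 : 0 < t) (ht1 : t < 1) :
    ∃ q ∈ C, T q = q ∧
      Tendsto (fun n => toWeakSpace ℝ E (kmIter T t x₀ n)) atTop (𝓝 (toWeakSpace ℝ E q)) := by
  obtain ⟨q, hqC, hq, -, -, hw⟩ :=
    kmIter_weak_tendsto_of_mapsTo hCconv hCcl hCbd hT hmaps hx₀ ht0 ht1
  exact ⟨q, hqC, hq, tendsto_toWeakSpace_of_forall_inner hw⟩

/-- **[Ber07, Thm 3.3] = [BrP67, Thm 7] as printed**: if moreover `T` has exactly one fixed point
`p` in `C` (`F_T = {p}`), then the Krasnoselskij iteration converges weakly to `p` for every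
`x₀ ∈ C`. [cite: Berinde2007, Ch. 3 §3.1, Thm 3.3] [cite: BrowderPetryshyn1967, Thm 7] -/
theorem kmIter_weak_tendsto_of_unique_fixedPoint {C : Set E} (hCconv : Convex ℝ C)
    (hCcl : IsClosed C) (hCbd : Bornology.IsBounded C)
    (hT : ∀ x ∈ C, ∀ y ∈ C, ‖T x - T y‖ ≤ ‖x - y‖) (hmaps : Set.MapsTo T C C)
    (huniq : ∀ q ∈ C, T q = q → q = p) (hx₀ : x₀ ∈ C) (ht0 : 0 < t) (ht1 : t < 1) :
    (∀ y : E, Tendsto (fun n => ⟪y, kmIter T t x₀ n⟫) atTop (𝓝 ⟪y, p⟫)) ∧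
      Tendsto (fun n => toWeakSpace ℝ E (kmIter T t x₀ n)) atTop (𝓝 (toWeakSpace ℝ E p)) := by
  obtain ⟨q, hqC, hq, -, -, hw⟩ :=
    kmIter_weak_tendsto_of_mapsTo hCconv hCcl hCbd hT hmaps hx₀ ht0 ht1
  obtain rfl := huniq q hqC hq
  exact ⟨hw, tendsto_toWeakSpace_of_forall_inner hw⟩

end Krasnoselskij

/-! ## Bridges: bounded weak limits, the un-squared radius, the tree's `OpialCondition` and
`demiclosedOn` in Hilbert space -/

/-- **Weakly convergent sequences in a Hilbert space are bounded** (uniform boundedness principle,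
Mathlib's `banach_steinhaus`, applied to the functionals `⟪u_n, ·⟫`). [cite: Berinde2007, Ch. 3
§3.1, Thm 3.3 (weak convergence `⇀`)] -/
theorem exists_norm_le_of_weak_tendsto [CompleteSpace E] {u : ℕ → E} {q : E}
    (hw : ∀ y : E, Tendsto (fun n => ⟪y, u n⟫) atTop (𝓝 ⟪y, q⟫)) : ∃ R : ℝ, ∀ n, ‖u n‖ ≤ R := by
  have h : ∀ x : E, ∃ C : ℝ, ∀ n, ‖(innerSL ℝ (u n)) x‖ ≤ C := fun x => by
    obtain ⟨C, hC⟩ := (Metric.isBounded_range_of_tendsto _ (hw x)).exists_norm_le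
    refine ⟨C, fun n => ?_⟩
    rw [innerSL_apply_apply, real_inner_comm]
    exact hC _ (Set.mem_range_self n)
  obtain ⟨C', hC'⟩ := banach_steinhaus h
  exact ⟨C', fun n => by simpa using hC' n⟩

omit [InnerProductSpace ℝ E] in
/-- The squared and un-squared asymptotic radii: `r_u(z) = (limsup_n ‖u_n − z‖)²` ([GK90, (9.1)]
uses the un-squared radius). [cite: GoebelKirk1990, Ch. 9, (9.1)] -/
theorem asymRadiusSq_eq_limsup_norm_sq (hu : ∀ n, ‖u n‖ ≤ R) (z : E) :
    asymRadiusSq u z = (limsup (fun n => ‖u n - z‖) atTop) ^ 2 := by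
  set f : ℝ → ℝ := fun x => (max x 0) ^ 2 with hf
  have hmono : Monotone f := fun a b h => by
    simp only [hf]
    exact pow_le_pow_left₀ (le_max_right _ _) (max_le_max h le_rfl) 2
  have hcont : Continuous f := by fun_prop
  have hbz : ∀ n, ‖u n - z‖ ≤ R + ‖z‖ := fun n => (norm_sub_le _ _).trans (add_le_add (hu n) le_rfl)
  have hb : IsBoundedUnder (· ≤ ·) atTop (fun n => ‖u n - z‖) :=
    Filter.isBoundedUnder_of ⟨R + ‖z‖, fun n => hbz n⟩
  have hcb : IsCoboundedUnder (· ≤ ·) atTop (fun n => ‖u n - z‖) :=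
    Filter.isCoboundedUnder_le_of_le atTop fun n => norm_nonneg _
  have key := hmono.map_limsup_of_continuousAt (F := atTop) (fun n => ‖u n - z‖)
    hcont.continuousAt hb hcb
  have hL0 : 0 ≤ limsup (fun n => ‖u n - z‖) atTop :=
    le_limsup_of_forall_le (fun n => norm_nonneg _) hbz
  have e1 : f (limsup (fun n => ‖u n - z‖) atTop) = (limsup (fun n => ‖u n - z‖) atTop) ^ 2 := by
    simp only [hf, max_eq_left hL0]
  have e2 : (f ∘ fun n => ‖u n - z‖) = fun n => ‖u n - z‖ ^ 2 := by
    funext n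
    simp only [hf, Function.comp_apply, max_eq_left (norm_nonneg _)]
  rw [asymRadiusSq, ← e2, ← key, e1]

/-- **Opial's condition, un-squared `WeakSpace` form**: in a real inner product space, if the
bounded sequence `u_n` converges weakly to `x₀` then `limsup ‖u_n − x₀‖ < limsup ‖u_n − y‖` for
every `y ≠ x₀` ([Ber07, Exercise 3.18]: "any Hilbert space satisfies Opial's condition").
[cite: Berinde2007, Ch. 3, Exercise 3.18] [cite: Opial1967, Lemma 1] -/
theorem limsup_norm_sub_lt_of_tendsto_toWeakSpace {u : ℕ → E} {x₀ y : E}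
    (hub : Bornology.IsBounded (Set.range u))
    (hw : Tendsto (fun n => toWeakSpace ℝ E (u n)) atTop (𝓝 (toWeakSpace ℝ E x₀)))
    (hy : y ≠ x₀) :
    limsup (fun n => ‖u n - x₀‖) atTop < limsup (fun n => ‖u n - y‖) atTop := by
  obtain ⟨M, hM⟩ := hub.exists_norm_le
  have hu : ∀ n, ‖u n‖ ≤ M := fun n => hM _ (Set.mem_range_self n)
  have h := asymRadiusSq_lt_of_weak_tendsto hu (forall_inner_of_tendsto_toWeakSpace hw) hy
  rw [asymRadiusSq_eq_limsup_norm_sq hu, asymRadiusSq_eq_limsup_norm_sq hu] at h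
  have h0 : 0 ≤ limsup (fun n => ‖u n - y‖) atTop :=
    le_limsup_of_forall_le (fun n => norm_nonneg _)
      (fun n => (norm_sub_le _ _).trans (add_le_add (hu n) le_rfl))
  exact lt_of_pow_lt_pow_left₀ 2 h0 h

variable (E) in
/-- **Every real inner product space satisfies Opial's condition** in the form recorded by the
tree (`IshikawaNonexpansive.OpialCondition E`, the hypothesis `hO` of its Theorems 5.4–5.5).
[cite: Berinde2007, Ch. 3, Exercise 3.18; Ch. 5 §5.3, p. 121] [cite: Opial1967, Lemma 1] -/
theorem opialCondition : IshikawaNonexpansive.OpialCondition E :=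
  ⟨fun _ _ hub hw _ hy => limsup_norm_sub_lt_of_tendsto_toWeakSpace hub hw hy⟩

/-- **`I − T` is demiclosed on `C` for nonexpansive `T` in Hilbert space**, in the tree's sense
`MannQuasiNonexpansive.demiclosedOn` (the hypothesis `hdemi` of its Theorem 4.7 (i)): `C` closed
convex, `T` nonexpansive on `C`, `u_n ∈ C`, `u_n ⇀ y ∈ C` and `u_n − T u_n → w` imply
`y − T y = w` ([Ber07, Ch. 4, Remark 2 after Thm 4.7]: a Hilbert space is uniformly convex with
weakly continuous duality map). Reduced to `apply_eq_of_weak_tendsto` for the nonexpansive map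
`x ↦ T (P_C x) + w`. [cite: Berinde2007, Ch. 4 §4.2, Remark 2 after Thm 4.7]
[cite: Opial1967, Lemma 2] -/
theorem demiclosedOn_of_nonexpansiveOn [CompleteSpace E] {C : Set E} {T : E → E}
    (hCconv : Convex ℝ C) (hCcl : IsClosed C) (hT : ∀ x ∈ C, ∀ y ∈ C, ‖T x - T y‖ ≤ ‖x - y‖) :
    MannQuasiNonexpansive.demiclosedOn T C := by
  intro u y w huC hyC hw hres
  have hCne : C.Nonempty := ⟨u 0, huC 0⟩
  have hw' := forall_inner_of_tendsto_toWeakSpace hw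
  obtain ⟨R, hR⟩ := exists_norm_le_of_weak_tendsto hw'
  set S : E → E := fun x => T (ConvexMetricProjection.proj C x) + w with hS
  have hSne : ∀ a b, ‖S a - S b‖ ≤ ‖a - b‖ := fun a b => by
    simp only [hS, add_sub_add_right_eq_sub]
    exact norm_comp_proj_sub_le hCconv hCcl hCne hT a b
  have hSres : Tendsto (fun n => ‖u n - S (u n)‖) atTop (𝓝 0) := by
    have e : ∀ n, u n - S (u n) = (u n - T (u n)) - w := fun n => by
      simp only [hS, ConvexMetricProjection.proj_eq_self hCne hCcl.isComplete hCconv (huC n)]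
      abel
    rw [← tendsto_zero_iff_norm_tendsto_zero]
    have h2 := hres.sub_const w
    rw [sub_self] at h2
    exact h2.congr fun n => (e n).symm
  have hSy : S y = y := apply_eq_of_weak_tendsto hSne hR hw' hSres
  simp only [hS, ConvexMetricProjection.proj_eq_self hCne hCcl.isComplete hCconv hyC] at hSy
  exact sub_eq_iff_eq_add'.2 hSy.symm

/-! ## Picard iteration of an asymptotically regular nonexpansive map -/

/-- **Picard iteration of an asymptotically regular nonexpansive map** ([Ber07, Exercise 3.19 and
§3.6]: Browder–Petryshyn; Opial): in a real Hilbert space let `T` be nonexpansive with a fixed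
point and asymptotically regular at `x₀` (`‖T^n x₀ − T^{n+1} x₀‖ → 0`). Then `T^n x₀` converges
weakly to a fixed point of `T` (its asymptotic centre). [cite: Berinde2007, Ch. 3, Exercise 3.19]
[cite: Opial1967, Thm 2] [cite: BrowderPetryshyn1967, §3.6 of Berinde2007] -/
theorem iterate_weak_tendsto_of_asymptoticallyRegular [CompleteSpace E] {T : E → E} {p : E}
    (hT : ∀ x y, ‖T x - T y‖ ≤ ‖x - y‖) (hp : T p = p) (x₀ : E)
    (hreg : Tendsto (fun n => ‖T^[n] x₀ - T^[n + 1] x₀‖) atTop (𝓝 0)) :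
    ∃ q, T q = q ∧ IsAsymCenter (fun n => T^[n] x₀) q ∧
      ∀ y : E, Tendsto (fun n => ⟪y, T^[n] x₀⟫) atTop (𝓝 ⟪y, q⟫) := by
  have hfej : ∀ q, T q = q → ∀ n, ‖T^[n + 1] x₀ - q‖ ≤ ‖T^[n] x₀ - q‖ := fun q hq n => by
    rw [Function.iterate_succ_apply']
    calc ‖T (T^[n] x₀) - q‖ = ‖T (T^[n] x₀) - T q‖ := by rw [hq]
      _ ≤ ‖T^[n] x₀ - q‖ := hT _ _
  have hle : ∀ n, ‖T^[n] x₀ - p‖ ≤ ‖x₀ - p‖ := fun n => by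
    induction n with
    | zero => simp
    | succ n ih => exact (hfej p hp n).trans ih
  have hb : ∀ n, ‖T^[n] x₀‖ ≤ ‖x₀ - p‖ + ‖p‖ := fun n =>
    calc ‖T^[n] x₀‖ = ‖(T^[n] x₀ - p) + p‖ := by rw [sub_add_cancel]
      _ ≤ ‖T^[n] x₀ - p‖ + ‖p‖ := norm_add_le _ _
      _ ≤ ‖x₀ - p‖ + ‖p‖ := add_le_add (hle n) le_rfl
  have hres : Tendsto (fun n => ‖T^[n] x₀ - T (T^[n] x₀)‖) atTop (𝓝 0) := by
    refine hreg.congr fun n => ?_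
    rw [Function.iterate_succ_apply']
  exact exists_fixedPoint_weak_tendsto hT hb hres hfej

end Literature.Analysis.Convex.KrasnoselskijWeakConvergence
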